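import Summits.PneNP.PneNP.Theorems.ConvexRankGatesCaptureTwoStepSpan
import Summits.PneNP.PneNP.Theorems.ConvexRankGatesCaptureSpanProgramGate
import Summits.PneNP.PneNP.Theorems.ConvexRankGatesCaptureSpanPrep
import Summits.PneNP.PneNP.Theorems.ConvexRankGatesCaptureSpanPrep2
import Summits.PneNP.PneNP.Theorems.ConvexRankGatesCaptureQuadSection
import Summits.PneNP.PneNP.Theorems.ConvexRankGatesCaptureAffineLemmas
import Summits.PneNP.PneNP.Theorems.ConvexRankGatesCaptureQuadDivision
import Summits.PneNP.PneNP.Theorems.ConvexRankGatesCaptureTwoStepStructure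
import HarnessLib

/-!
# Crux `Capture` (stmt-PneNP-2659), line `csp-spine-meet-to-join` rev 4/5 — Theorem A assembled:
# `stub_twoStepCore` (rev-4 Stub C) and `stub_twoStepCosetCaptureLanded` (rev-5 Stub T, gate level)

The registered stub `stub_twoStepCore` of the skeleton `Cruxes/Capture/Lines/csp_spine_meet_to_join.lean`:
given the two `𝔽₂` lemmas `AffineDual`, `QuadDivision` and bilinear two-step coordinates `(x, z, β)` of a
group `G` (all squares central, exponent `4`: `D₄`, `Q₈`, extraspecial `2^{1+2k}`, `ℤ/4 × …`), the UNSAT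
function of ANY selected coset system over `G` (variables `Fin nv`, constraint `j` = "restriction to
`scope j` lies in `c j · H j`", `H j ≤ G^{r j}`) is computed by ONE gate of `permBasis S` — an `𝔽₂` span
program on `nv·k + (nv·k)² + nv·l` coordinates — whenever `2·(nv·l + 1 + nv·k + (nv·k)²) ≤ S`.

This file only ASSEMBLES the landed pieces: the span form `twoStep_unsat_iff_span_of`
(`ConvexRankGatesCaptureTwoStepSpan.lean`, consuming `span_prep_lemmas`, `span_prep_lemmas2`,
`quad_section`, `central_certificate`) and the PERM plumbing `span_program_cktSize`
(`ConvexRankGatesCaptureSpanProgramGate.lean`). The hypothesis `AffineDual` of the registered signature is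
not needed by the landed span form (the central certificate replaced it) and is discarded. The gate-level
corollary `stub_twoStepCosetCaptureLanded` (registered stub of skeleton rev 5): every COSET gate of parameter `s` over a
group with all squares central and exponent `4` is computed by a `permBasis ((s+2)^5)`-circuit with `≤ (s+2)^5` gates
(size bookkeeping `k, l ≤ |G| ≤ s`, `nv ≤ s`). Continuation lead c2, 2026-08-16. [folklore]
-/

namespace Summit.PneNP.PneNP.Cruxes.Capture.CspSpineMeetToJoin

set_option linter.dupNamespace false -- `Summit.PneNP.PneNP.…`: summit = sub-problem (D-0017)

open Literature.Computability.Complexity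

/-- **Stub C — `TwoStepCore` (Theorem A)**, registered stub of line `csp-spine-meet-to-join` (rev 4),
signature verbatim: `AffineDual → QuadDivision → ∀ G` with bilinear two-step coordinates `(x, z, β)`,
`∀` coset-CSP data `(scope, H, c)` and `f` its UNSAT function, `∀ S ≥ 2·(nv·l + 1 + nv·k + (nv·k)²)`,
`CktSize (permBasis S) (fun v _ => f v) 1`. Proof: `twoStep_unsat_iff_span_of` turns UNSAT of the
selection `v` into `(0,1) ∈ span_{𝔽₂} (⋃_{v j} R j)` for `v`-independent relation blocks `R j`, and
`span_program_cktSize` realises that as one PERM gate. [folklore] -/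
theorem stub_twoStepCore :
    (∀ (ι κ : Type) [Fintype ι] [Fintype κ] (S : Set (ι → ZMod 2)),
      S.Nonempty → (∀ x ∈ S, ∀ y ∈ S, ∀ w ∈ S, x + y + w ∈ S) →
      ∀ (Ψ : (ι → ZMod 2) → κ → ZMod 2),
        (∀ x ∈ S, ∀ y ∈ S, ∀ w ∈ S, Ψ (x + y + w) = Ψ x + Ψ y + Ψ w) →
        (∀ x ∈ S, Ψ x ≠ 0) →
        ∃ μ : κ → ZMod 2, ∀ x ∈ S, ∑ t, μ t * Ψ x t = 1) →
    (∀ (ι V : Type) [Fintype ι] [DecidableEq ι] [Fintype V]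
      (e : V → ZMod 2 × (ι → ZMod 2)) (p : ZMod 2 × (ι → ZMod 2) × (ι × ι → ZMod 2)),
      (∃ x : ι → ZMod 2, ∀ v, (e v).1 + ∑ i, (e v).2 i * x i = 0) →
      (∀ x : ι → ZMod 2, (∀ v, (e v).1 + ∑ i, (e v).2 i * x i = 0) →
        p.1 + ∑ i, p.2.1 i * x i + ∑ i, ∑ j, p.2.2 (i, j) * (x i * x j) = 0) →
      p ∈ Submodule.span (ZMod 2)
        (Set.range (fun v : V => ((e v).1, (e v).2, (0 : ι × ι → ZMod 2))) ∪
         Set.range (fun vi : V × ι => ((0 : ZMod 2), Pi.single vi.2 (e vi.1).1,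
            fun ab : ι × ι => if ab.1 = vi.2 then (e vi.1).2 ab.2 else 0)) ∪
         Set.range (fun i : ι => ((0 : ZMod 2), Pi.single i (1 : ZMod 2), Pi.single (i, i) (1 : ZMod 2))) ∪
         Set.range (fun ij : ι × ι => ((0 : ZMod 2), (0 : ι → ZMod 2),
            Pi.single ij (1 : ZMod 2) + Pi.single (ij.2, ij.1) (1 : ZMod 2))))) →
    ∀ (G : Type) [Group G] [Fintype G] (k l : ℕ) (x : G → Fin k → ZMod 2)
      (z : G → Fin l → ZMod 2) (β : (Fin k → ZMod 2) → (Fin k → ZMod 2) → Fin l → ZMod 2),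
      (Function.Bijective (fun g => (x g, z g)) ∧ (∀ g h, x (g * h) = x g + x h) ∧
          (∀ g h, z (g * h) = z g + z h + β (x g) (x h)) ∧
          (∀ a a' b, β (a + a') b = β a b + β a' b) ∧ (∀ a b b', β a (b + b') = β a b + β a b')) →
      ∀ (nv m : ℕ) (r : Fin m → ℕ) (scope : (j : Fin m) → Fin (r j) → Fin nv)
        (H : (j : Fin m) → Subgroup (Fin (r j) → G)) (c : (j : Fin m) → Fin (r j) → G)
        (f : (Fin m → Bool) → Bool),
        (∀ v, f v = true ↔
          ¬ ∃ h : Fin nv → G, ∀ j, v j = true → (c j)⁻¹ * (fun i => h (scope j i)) ∈ H j) →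
        ∀ S : ℕ, 2 * (nv * l + 1 + nv * k + (nv * k) ^ 2) ≤ S →
          CktSize (permBasis S) (fun v (_ : Unit) => f v) 1 := by
  intro _ hQ G _ _ k l x z β hco nv m r scope H c f hf S hS
  classical
  obtain ⟨hbij, hx, hz, hβl, hβr⟩ := hco
  -- the coordinates and relation blocks of the span form (independent of the selection `v`)
  let Idx : Type := (Fin nv × Fin k) ⊕ ((Fin nv × Fin k) × (Fin nv × Fin k)) ⊕ (Fin nv × Fin l)
  let Yv : (Fin nv → G) → Idx → ZMod 2 := fun h => Sum.elim (fun p => x (h p.1) p.2)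
    (Sum.elim (fun pq => x (h pq.1.1) pq.1.2 * x (h pq.2.1) pq.2.2) (fun p => z (h p.1) p.2))
  let R : Fin m → Set ((Idx → ZMod 2) × ZMod 2) := fun j => {wb | ∀ h : Fin nv → G,
    (c j)⁻¹ * (fun i => h (scope j i)) ∈ H j → ∑ i, wb.1 i * Yv h i = wb.2}
  -- Theorem A in span form: UNSAT of the selection = `(0,1)` in the span of the selected blocks
  have key : ∀ v : Fin m → Bool,
      (¬ ∃ h : Fin nv → G, ∀ j, v j = true → (c j)⁻¹ * (fun i => h (scope j i)) ∈ H j) ↔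
        ((0 : Idx → ZMod 2), (1 : ZMod 2)) ∈
          Submodule.span (ZMod 2) (⋃ j ∈ {j | v j = true}, R j) :=
    fun v => twoStep_unsat_iff_span_of hQ span_prep_lemmas.2.1 span_prep_lemmas.2.2
      span_prep_lemmas2.1 span_prep_lemmas2.2 quad_section G k l x z β hbij hx hz hβl hβr nv m r
      scope H c v
  -- size of the coordinate type
  have hcard : Fintype.card Idx + 1 = nv * l + 1 + nv * k + (nv * k) ^ 2 := by
    simp only [Idx, Fintype.card_sum, Fintype.card_prod, Fintype.card_fin]
    ring
  -- one PERM gate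
  refine span_program_cktSize Idx m R f (fun v => (hf v).trans (key v)) S ?_
  rw [hcard]
  exact hS

/-- **Stub T — `TwoStepCosetCaptureLanded`** (registered stub of skeleton rev 5 of line `csp-spine-meet-to-join`;
Theorem A at gate level): every two-step COSET gate (coset-CSP data over a finite group with all squares central and
`g⁴ = 1`, size parameter `s`) is computed by a circuit over `{∧₂,∨₂,1,0} ∪ PERM_{(s+2)^5}` with at most `(s+2)^5`
gates (in fact one PERM gate). Composition of the landed `stub_affineLemmas`, `stub_quadDivision`,
`stub_twoStepStructure` and `stub_twoStepCore`. [folklore] -/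
theorem stub_twoStepCosetCaptureLanded :
    ∀ (s : ℕ) (g : GateFn), (g.1 ≤ s ∧ ∃ (G : Type) (_ : Group G) (_ : Fintype G) (nv : ℕ),
      ((∀ a y : G, a ^ 2 * y = y * a ^ 2) ∧ (∀ a : G, a ^ 4 = 1)) ∧
      Fintype.card G ≤ s ∧ nv ≤ s ∧
      ∃ (r : Fin g.1 → ℕ) (scope : (j : Fin g.1) → Fin (r j) → Fin nv)
        (H : (j : Fin g.1) → Subgroup (Fin (r j) → G)) (c : (j : Fin g.1) → Fin (r j) → G),
        (∀ j, Fintype.card G ^ r j ≤ s) ∧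
        ∀ v : Fin g.1 → Bool, g.2 v = true ↔
          ¬ ∃ h : Fin nv → G, ∀ j, v j = true → (c j)⁻¹ * (fun i => h (scope j i)) ∈ H j) →
      ∃ C : Circuit (Fin g.1), C.IsOver (permBasis ((s + 2) ^ 5)) ∧ C.size ≤ (s + 2) ^ 5 ∧
        C.Computes g.2 := by
  intro s g hg
  obtain ⟨-, G, iG, iF, nv, ⟨hsq, hexp⟩, hG, hnv, r, scope, H, c, -, hiff⟩ := hg
  obtain ⟨k, l, x, z, β, hcard, hcoords⟩ := stub_twoStepStructure G hsq hexp
  -- size bookkeeping: `k, l < |G| ≤ s`, `nv ≤ s`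
  have hk : k ≤ s := by
    have h1 : 2 ^ k ≤ Fintype.card G := by
      calc 2 ^ k = 2 ^ k * 1 := (mul_one _).symm
        _ ≤ 2 ^ k * 2 ^ l := Nat.mul_le_mul_left _ (Nat.one_le_two_pow)
        _ = Fintype.card G := hcard
    exact ((Nat.lt_two_pow_self).le.trans h1).trans hG
  have hl : l ≤ s := by
    have h1 : 2 ^ l ≤ Fintype.card G := by
      calc 2 ^ l = 1 * 2 ^ l := (one_mul _).symm
        _ ≤ 2 ^ k * 2 ^ l := Nat.mul_le_mul_right _ (Nat.one_le_two_pow)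
        _ = Fintype.card G := hcard
    exact ((Nat.lt_two_pow_self).le.trans h1).trans hG
  have hS5 : 2 * (nv * l + 1 + nv * k + (nv * k) ^ 2) ≤ (s + 2) ^ 5 := by
    have h1 : nv * l ≤ s * s := Nat.mul_le_mul hnv hl
    have h2 : nv * k ≤ s * s := Nat.mul_le_mul hnv hk
    have h3 : (nv * k) ^ 2 ≤ (s * s) ^ 2 := Nat.pow_le_pow_left h2 2
    have h4 : 2 * (s * s + 1 + s * s + (s * s) ^ 2) ≤ (s + 2) ^ 5 := by
      have : s * s + 1 + s * s + (s * s) ^ 2 ≤ (s + 2) ^ 4 := by nlinarith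
      calc 2 * (s * s + 1 + s * s + (s * s) ^ 2) ≤ 2 * (s + 2) ^ 4 := Nat.mul_le_mul_left _ this
        _ ≤ (s + 2) * (s + 2) ^ 4 := Nat.mul_le_mul_right _ (by omega)
        _ = (s + 2) ^ 5 := by ring
    exact le_trans (by omega) h4
  have hcore := stub_twoStepCore stub_affineLemmas.1 (stub_quadDivision stub_affineLemmas.2) G k l x z β hcoords
    nv g.1 r scope H c g.2 hiff ((s + 2) ^ 5) hS5
  obtain ⟨C, hCB, hCs, hCe⟩ := hcore.toCircuit
  exact ⟨C, hCB, hCs.trans (Nat.one_le_pow _ _ (by omega)), fun v => hCe v⟩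

end Summit.PneNP.PneNP.Cruxes.Capture.CspSpineMeetToJoin
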